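import Summits.QuantumFields.YangMills.Theorems.BalabanUVNodesN27SpineGivenEndpointR11
import Literature.MathematicalPhysics.QuantumFieldTheory.Balaban1983to89.B16Thm1BaseAtRecord11

/-!
# BalabanUVNodes ∕ N27 = binder B5 AT THE RECORD, XXIII — VACUITY CERTIFICATE FOR THE REV-1 ITEM K3 `Theses.BalabanUVNodes.SpineGivenEndpointR11`
# (stmt-QuantumFields-19676) AT NODE 00's STAGE-11 RECORD AS PINNED: the item holds EX FALSO at EVERY Stage-11 record — its antecedents «record, (B), END»
# are jointly contradictory, and even under (B) alone the whole apex prefix `FiniteEpsData.UnderHypotheses` is provable for every conclusion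
# (cell `pub-ymgap`, HUMAN RULING D-0062 Track A, R134 seat `pub-ymgap-dag-n27-c` (s2) gen 2; `--supports stmt-QuantumFields-19676`, NEVER `--workitem`;
# chair R457 (A): a VACUITY CERTIFICATE is count-neutral located knowledge, NOT a discharge; director LINE №81∕№86: nobody closes 19676 on it; the item is HELD
# (R166) and retires to `aside` at rev 8, where K3′ is re-keyed to `Node00.IsRecordOfRecord₁₂C`)

WHY THIS FILE.  dag-n13-e LOCATED (pub-ymgap INBOX l.12353, kernel `Literature/…/B16Thm1BaseAtRecord11.lean` p455067 ✓) that at the Stage-11 record AS PINNED the level-0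
§2-form slot reads no configuration, so `Node00.SLaw₁₁ θ P 0` is FALSE for `N ≥ 2`, `g₀ ≠ 0` (`not_sLaw₁₁_zero`), hence [Balaban1989LargeFieldII] Thm 1 as pinned,
`B16.Thm1Printed (datumOfRecord₁₁ F N θ h).C`, FAILS as soon as some run lies in every small coupling window (`not_endStatementBPrinted_of_isRecordOfRecord₁₁C_of_window`);
dag-ref-D (VACUITY-AMENDMENT l.12476) read K3 as «ex-falso-closable at every WINDOWED record».  This module certifies the sharper statement from the K3 seat (director
LINE №81 (1) asked whether K3's hypotheses pass through `SLaw₁₁ … 0` — THEY DO, at every record):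
* ROAD (i) — THE ANTECEDENTS ARE CONTRADICTORY AT EVERY RECORD: K3's third antecedent END = `DagBinding.EndpointExistence D.C.toB12` supplies, for every torus exponent and all
  small `γ`, `g`, a run `⟨K, m, g0⟩` in the window `]0, γ]` (`window_of_endpointExistence`: exactly K1's clause `∃ γ₁ > 0, ∀ γ ∈ ]0, γ₁], ∃ P, 1 ≤ P.K ∧ InInterval γ P.K`),
  so «`IsRecordOfRecord₁₁C F N D w` → (B) → END → `False`» (`false_of_isRecordOfRecord₁₁C_endStatementB_endpoint`, `N ≥ 2`).
* ROAD (ii) — UNDER (B) ALONE THE APEX PREFIX IS VACUOUS: `ForSmallCouplings D concl` (= `∃ γ₀ > 0, ∀ γ ∈ ]0, γ₀], ∃ g₁ > 0, ∀ g ∈ ]0, g₁], ∀ g₀, D.Tuned γ g g₀ → concl g₀`,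
  T4ContinuumYM4Torus :258) holds for EVERY `concl` once `B16.Thm1Printed D.C` holds and the construction has no level-0 §2 form at positive bare coupling
  (`forSmallCouplings_of_thm1Printed_of_not_sect2Form_zero`, generic `FiniteEpsData`): choose `γ₀ :=` Theorem 1's own `γ`; a tuned `g₀` puts the run `⟨0, F.m, g₀ 0⟩`
  in `]0, γ]` (`FiniteEpsData.Tuned` :866 quantifies EVERY `K`, `K = 0` included), Theorem 1 gives `Sect2Form 0` there, at bare coupling `g₀ 0 > 0` — contradiction.
  Hence at every Stage-11 record: `ForSmallCouplings D concl` under (B) (`forSmallCouplings_of_isRecordOfRecord₁₁C_endStatementB`), `D.UnderHypotheses Hβ concl` for every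
  `Hβ`, `concl` (`underHypotheses_of_isRecordOfRecord₁₁C`), and so B5 `Spine ₁₁C`, K4's hook `SpineRates ₁₁C Inputs` and K5 `SpineMatching ₁₁C Inputs` of the cut
  (`BalabanUVNodesClustersCore` :301∕:320∕:326) hold WITH NO ESTIMATE (`spine_rec11C_of_vacuity`, `spineRates_rec11C_of_vacuity`, `spineMatching_rec11C_of_vacuity`;
  `N`-generic, `N ≥ 2`).
* THE CERTIFICATE (`N = 2`, the route's instantiation): **`spineGivenEndpointR11_of_vacuity : SpineGivenEndpointR11`** (XXI `spineGivenEndpointR11_of_spine_rec11C` ∘ road (ii);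
  road (i) gives the same term by `absurd`).  A third, blunter road — the record class `IsRecordOfRecord₁₁C` is itself EMPTY (`Stage11Params.Provisos₁₁.alphaPos` over all
  runs incl. `g₀ = 0`; node00-def-T LOCATED-2, INBOX l.12862, kernel probe not in the tree) — is NOT used here.

WHAT THIS MEANS FOR THE N27 MODULES XII–XXII (n27-a ∕ n27-c lineage).  Every ₁₁-keyed knit of K3 (XX–XXII, (T-SPINE) `YMDAG.UVSplit.SRec₁₁`, (T-RATE) `RRec₁₁`) is a
CORRECT implication whose conclusion is provable ex falso at Stage 11 as pinned; the WIRING is what survives: at def-T's repaired record `Record12` (level-0 background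
`U₀ := 𝐖 ↦ 𝐖 0` by value, base `sLaw₁₂_zero` a THEOREM, no all-runs radii field) NONE of the terms below type-checks — `not_sLaw₁₁_zero` has no ₁₂ analogue — so the
re-keyed item K3′ over `IsRecordOfRecord₁₂C` has content, and the knits re-instantiate there (director LINE №81 (3)).

HONEST FRAMING.  VACUITY CERTIFICATE ∕ located knowledge about the tree's OWN Stage-11 pin: nothing of Bałaban's is asserted or refuted; no estimate is proved; NO node is
discharged and the item K3 is NOT claimed — it is HELD (R166) precisely because of the mechanism certified here; counts UNMOVED (typed 28∕28 · discharged 5∕27, A 5∕28).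
One finite four-torus programme at fixed `ε`, Bałaban AS PRINTED; NOT ℝ⁴, NOT infinite volume, NOT OS, NOT a mass gap, NOT Clay.  0 `def`, 0 `sorry`, standard axioms;
route-facing only through XXI (the `N = 2` certificate); §§1–3 are `N`-generic and Theses-free in content.  No decl below carries a cite tag.
-/

namespace Summit.QuantumFields.YangMills.Theorems.BalabanUVNodesN27SpineRecord

open Literature.MathematicalPhysics.QuantumFieldTheory.Balaban1983to89
open Literature.MathematicalPhysics.QuantumFieldTheory.Balaban1983to89.T4Continuum
open T4ContinuumYM4Torus (ForSmallCouplings)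
open Summit.QuantumFields.YangMills.Theses.BalabanUVNodes (SpineGivenEndpointR11)
open YMDAG.UVSplit
open Node00 (Stage11Params datumOfRecord₁₁ IsRecordOfRecord₁₁C)

/-! ## §1 Road (i): END supplies the window, so «record ∧ (B) ∧ END» is contradictory at every Stage-11 record -/

section Window

/-- **END ⇒ THE WINDOW CLAUSE OF K1**: endpoint existence for `C.toB12` ([Balaban1987RG1] Thm 2's existence half, `DagBinding.EndpointExistence`) yields, at torus exponent
`m = 0`, a threshold `γ₁ > 0` such that every window `]0, γ]`, `γ ≤ γ₁`, contains a run of `C` with `K = 1` steps — verbatim the non-vacuity clause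
`∃ γ₁ > 0, ∀ γ ∈ ]0, γ₁], ∃ P, 1 ≤ P.K ∧ (C P).flow.InInterval γ P.K` of the route's K1∕K2 items. [bookkeeping] -/
theorem window_of_endpointExistence (C : B16.Construction) (hE : DagBinding.EndpointExistence C.toB12) :
    ∃ γ₁ : ℝ, 0 < γ₁ ∧ ∀ γ : ℝ, 0 < γ → γ ≤ γ₁ → ∃ P : B12.RunParams, 1 ≤ P.K ∧ (C P).flow.InInterval γ P.K := by
  obtain ⟨γ₂, hγ₂, hγ⟩ := hE 0
  refine ⟨γ₂, hγ₂, fun γ hγ0 hγle => ?_⟩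
  obtain ⟨gstar, hgstar, hg⟩ := hγ γ hγ0 hγle
  obtain ⟨g0, hI, -⟩ := hg (min gstar γ) (lt_min hgstar hγ0) (min_le_left _ _) 1
  exact ⟨⟨1, 0, g0⟩, le_rfl, hI⟩

variable {N : ℕ} [NeZero N]

/-- **K3's ANTECEDENTS ARE JOINTLY CONTRADICTORY AT EVERY STAGE-11 RECORD** (`N ≥ 2`): a Stage-11 record pair `(D, w)`, the pin (B) `B16.EndStatementBPrinted D.C` and END
`DagBinding.EndpointExistence D.C.toB12` cannot coexist — END puts runs in every small window (`window_of_endpointExistence`), and there (B) fails as pinned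
(dag-n13-e's `B16Thm1BaseAtRecord11.not_endStatementBPrinted_of_isRecordOfRecord₁₁C_of_window`: the level-0 §2 slot of record is constant, `ρ₀` is not).  No «windowed
record» proviso: the window is END's. [bookkeeping] -/
theorem false_of_isRecordOfRecord₁₁C_endStatementB_endpoint (hN : 2 ≤ N) {F : T4Family} {D : Datum F N} {w : DagBinding.WorldP}
    (hrec : IsRecordOfRecord₁₁C F N D w) (hB : B16.EndStatementBPrinted D.C) (hE : DagBinding.EndpointExistence D.C.toB12) : False :=
  B16Thm1BaseAtRecord11.not_endStatementBPrinted_of_isRecordOfRecord₁₁C_of_window F N hN hrec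
    (by
      obtain ⟨γ₁, hγ₁, hw⟩ := window_of_endpointExistence D.C hE
      exact ⟨γ₁, hγ₁, fun γ hγ hγ' => by
        obtain ⟨P, -, hP⟩ := hw γ hγ hγ'
        exact ⟨P, hP⟩⟩)
    hB

end Window

/-! ## §2 Road (ii): under Theorem 1 as pinned, the apex prefix `ForSmallCouplings` ∕ `UnderHypotheses` holds for EVERY conclusion -/

section Prefix

/-- **THEOREM 1 + «NO LEVEL-0 §2 FORM AT POSITIVE BARE COUPLING» ⇒ EVERY `ForSmallCouplings D concl`** (generic finite-`ε` data `D`, any gauge group): take `γ₀ :=` Theorem 1's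
`γ`; for `γ ≤ γ₀`, any `g`, and a bare sequence `g₀` tuned within `]0, γ]` (`D.Tuned γ g g₀`: EVERY run `⟨K, F.m, g₀ K⟩` stays in `]0, γ]`, the run `K = 0` included), the run
`⟨0, F.m, g₀ 0⟩` lies in Theorem 1's window, so `Sect2Form 0` holds for it — at bare coupling `(D.C _).flow.g 0 > 0`, where the hypothesis says it cannot.  So the
conclusion is never examined. [bookkeeping] -/
theorem forSmallCouplings_of_thm1Printed_of_not_sect2Form_zero {F : T4Family} {G : Type} [GaugeGroup G] [MeasurableSpace G] [HaarData G]
    (D : FiniteEpsData F G) (hT : B16.Thm1Printed D.C)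
    (hneg : ∀ P : B12.RunParams, 0 < (D.C P).flow.g 0 → ¬ (D.C P).Sect2Form 0) (concl : (ℕ → ℝ) → Prop) :
    ForSmallCouplings D concl := by
  obtain ⟨γT, hγT, hall⟩ := hT
  refine ⟨γT, hγT, fun γ _ hγle => ⟨1, one_pos, fun g _ _ g₀ htuned => ?_⟩⟩
  have hI : (D.C ⟨0, F.m, g₀ 0⟩).flow.InInterval γ 0 := (htuned 0).1
  have hIT : (D.C ⟨0, F.m, g₀ 0⟩).flow.InInterval γT 0 := fun k hk => ⟨(hI k hk).1, (hI k hk).2.trans hγle⟩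
  exact absurd (hall ⟨0, F.m, g₀ 0⟩ hIT 0 le_rfl) (hneg _ (hI 0 le_rfl).1)

variable {N : ℕ} [NeZero N]

/-- **AT EVERY STAGE-11 RECORD, UNDER (B) ALONE, `ForSmallCouplings D concl` HOLDS FOR EVERY CONCLUSION** (`N ≥ 2`): (B).1 is Theorem 1, and at the Stage-11 datum the
construction's step-0 §2 clause fails on every run with non-zero bare coupling (`B16Thm1BaseAtRecord11.not_sect2Form_zero_datumOfRecord₁₁`). [bookkeeping] -/
theorem forSmallCouplings_of_isRecordOfRecord₁₁C_endStatementB (hN : 2 ≤ N) {F : T4Family} {D : Datum F N} {w : DagBinding.WorldP}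
    (hrec : IsRecordOfRecord₁₁C F N D w) (hB : B16.EndStatementBPrinted D.C) (concl : (ℕ → ℝ) → Prop) : ForSmallCouplings D concl := by
  obtain ⟨θ, h, -, rfl, -⟩ := hrec
  exact forSmallCouplings_of_thm1Printed_of_not_sect2Form_zero _ hB.1
    (fun P hg => B16Thm1BaseAtRecord11.not_sect2Form_zero_datumOfRecord₁₁ F N θ h hN P (ne_of_gt hg)) concl

/-- **THE WHOLE APEX PREFIX IS VACUOUS AT EVERY STAGE-11 RECORD**: `D.UnderHypotheses Hβ concl` (= `(B) → Hβ → ForSmallCouplings D concl`, T4Continuum :1055) for EVERY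
β-side hypothesis `Hβ` and EVERY conclusion `concl`, `N ≥ 2` — all four T⁴-apex targets' prefix, `HybridNE7Under` ∕ `StringwiseUnder` ∕ `GenFunCauchyUnder` included.
[bookkeeping] -/
theorem underHypotheses_of_isRecordOfRecord₁₁C (hN : 2 ≤ N) {F : T4Family} {D : Datum F N} {w : DagBinding.WorldP} (hrec : IsRecordOfRecord₁₁C F N D w)
    (Hβ : Prop) (concl : (ℕ → ℝ) → Prop) : D.UnderHypotheses Hβ concl :=
  fun hB _ => forSmallCouplings_of_isRecordOfRecord₁₁C_endStatementB hN hrec hB concl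

end Prefix

/-! ## §3 Consequently B5, K4's hook and K5 of the cut hold at `Rec := Node00.IsRecordOfRecord₁₁C F N` WITH NO ESTIMATE (`N ≥ 2`) -/

section Cut

variable {N : ℕ} [NeZero N]

/-- **B5 `Spine ₁₁C` HOLDS WITH NO ESTIMATE** (`N ≥ 2`): `Spine Rec = ∀ F D w, Rec F D w → HybridNE7Under D END` and `HybridNE7Under D END = D.UnderHypotheses END _`
(T4ApexHybrid :165) is vacuous at every Stage-11 record (`underHypotheses_of_isRecordOfRecord₁₁C`).  VACUITY, not a knit: no child's estimate enters. [bookkeeping] -/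
theorem spine_rec11C_of_vacuity (hN : 2 ≤ N) : Spine (N := N) fun F D w => IsRecordOfRecord₁₁C F N D w :=
  fun _ _ _ hR => underHypotheses_of_isRecordOfRecord₁₁C hN hR _ _

/-- **K4's CONCLUSION HOOK `SpineRates ₁₁C Inputs` HOLDS WITH NO ESTIMATE, for every `Inputs`** (`N ≥ 2`; ClustersCore :301: `Rec → (B) → END → ForSmallCouplings D _`).
[bookkeeping] -/
theorem spineRates_rec11C_of_vacuity (hN : 2 ≤ N) (Inputs : InputsPred N) :
    SpineRates (fun F D w => IsRecordOfRecord₁₁C F N D w) Inputs :=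
  fun _ _ _ hR hB _ => forSmallCouplings_of_isRecordOfRecord₁₁C_endStatementB hN hR hB _

/-- **K5 `SpineMatching ₁₁C Inputs` HOLDS WITH NO ESTIMATE, for every `Inputs`** (`N ≥ 2`; ClustersCore :320). [bookkeeping] -/
theorem spineMatching_rec11C_of_vacuity (hN : 2 ≤ N) (Inputs : InputsPred N) :
    SpineMatching (fun F D w => IsRecordOfRecord₁₁C F N D w) Inputs :=
  fun _ _ _ hR hB _ => forSmallCouplings_of_isRecordOfRecord₁₁C_endStatementB hN hR hB _

/-- The same three at `N = 2` WITHOUT the guard (the route's instantiation; `le_rfl`). [bookkeeping] -/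
theorem spine_rec11C_two_of_vacuity : Spine (N := 2) fun F D w => IsRecordOfRecord₁₁C F 2 D w :=
  spine_rec11C_of_vacuity le_rfl

end Cut

/-! ## §4 THE CERTIFICATE: the rev-1 item K3 at `N = 2` -/

section Certificate

/-- **VACUITY CERTIFICATE FOR K3 `SpineGivenEndpointR11` (stmt-QuantumFields-19676) — NOT A DISCHARGE.**  The item IS `Spine ₁₁C` at `N = 2` (XXI
`spineGivenEndpointR11_iff_spine_rec11C`), which holds with no estimate (`spine_rec11C_two_of_vacuity`, road (ii)); equivalently its antecedents «record, (B), END» are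
contradictory (`false_of_isRecordOfRecord₁₁C_endStatementB_endpoint`, road (i)).  Filed `--supports` only: under the cell's «no ex falso» rule (chair R457 (A), director LINE
№86 (1)) nobody closes the item on this term; it is HELD (R166) and is restated at the repaired Stage-12 record, where this proof does not type-check. [bookkeeping] -/
theorem spineGivenEndpointR11_of_vacuity : SpineGivenEndpointR11 :=
  spineGivenEndpointR11_of_spine_rec11C spine_rec11C_two_of_vacuity

/-- The same certificate by road (i) (`absurd` on the three antecedents; displayed so that both mechanisms are kernel-visible). [bookkeeping] -/
theorem spineGivenEndpointR11_of_vacuity' : SpineGivenEndpointR11 :=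
  fun _ _ _ hR hB hE => (false_of_isRecordOfRecord₁₁C_endStatementB_endpoint (N := 2) le_rfl hR hB hE).elim

end Certificate

end Summit.QuantumFields.YangMills.Theorems.BalabanUVNodesN27SpineRecord
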